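import Summits.AtomisticToContinuum.Crystallization.Theorems.ThreeConeCertificateDefs
import Literature.MathematicalPhysics.StatisticalMechanics.LennardJonesClusters

/-!
# `OnePercentCertificate` (stmt-AtomisticToContinuum-11958) — line `perron-gauge`: the pruning lemma

Line `perron-gauge-Sketch` (lead prover-line-stmt-AtomisticToContinuum-11958-a1-0; card `Ideas/perron-gauge.md`
rev 5, "pruning lemma").  For a pair potential `g` and a constant `c ≥ 0`, `c`-stability of `g` on injective
configurations ALL OF WHOSE SITE ENERGIES ARE `≤ 0` ("pruned" configurations) implies `c`-stability on all injective
configurations: a particle of positive site energy is deleted, which lowers the energy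
(`interactionEnergy_eq_succAbove_add_siteEnergy`) and keeps injectivity, and `−c·(N−1) ≥ −c·N`.  No hard core,
no ground states.  Together with `PerronGauge.stub_separated_of_siteEnergy_le` (p141961: site energies `≤ 1` ⇒
`1/8`-separated, for the tree split `gS`) the certification domain of the line is: injective, pruned (hence
`1/8`-separated) configurations.  General `g`, `c`; Props inlined, no definitions. [folklore]
-/

noncomputable section

open scoped BigOperators
open Literature.MathematicalPhysics.StatisticalMechanics

namespace Summit.AtomisticToContinuum.Crystallization.Theorems.PerronGauge

variable {d : ℕ}

/-- Sum over `univ.erase i` re-indexed through `Fin.succAbove`. [folklore] -/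
theorem sum_erase_eq_sum_succAbove {n : ℕ} (f : Fin (n + 1) → ℝ) (i : Fin (n + 1)) :
    ∑ j ∈ Finset.univ.erase i, f j = ∑ j : Fin n, f (i.succAbove j) := by
  rw [Finset.sum_erase_eq_sub (Finset.mem_univ i), Fin.sum_univ_succAbove f i]
  ring

/-- **Removal identity.** Deleting particle `i` from a configuration of `n + 1` particles removes exactly its
site energy: `E_g(x) = E_g(x ∘ i.succAbove) + 𝓔ⁱ(x)`. [folklore] -/
theorem interactionEnergy_eq_succAbove_add_siteEnergy (g : ℝ → ℝ) {n : ℕ}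
    (x : Fin (n + 1) → EuclideanSpace ℝ (Fin d)) (i : Fin (n + 1)) :
    interactionEnergy g x = interactionEnergy g (x ∘ i.succAbove) + siteEnergy g x i := by
  have h2 := two_mul_interactionEnergy g x
  have h2' := two_mul_interactionEnergy g (x ∘ i.succAbove)
  -- split the outer sum at `i`
  rw [Fin.sum_univ_succAbove _ i] at h2
  -- the site energies of the remaining particles
  have hsite : ∀ a : Fin n, siteEnergy g x (i.succAbove a)
      = g (dist (x (i.succAbove a)) (x i)) + siteEnergy g (x ∘ i.succAbove) a := by
    intro a
    unfold siteEnergy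
    rw [Finset.sum_erase_eq_sub (Finset.mem_univ _), Fin.sum_univ_succAbove _ i,
      Finset.sum_erase_eq_sub (Finset.mem_univ _)]
    simp only [Function.comp_apply]
    ring
  have hsum : ∑ a : Fin n, siteEnergy g x (i.succAbove a)
      = siteEnergy g x i + ∑ a : Fin n, siteEnergy g (x ∘ i.succAbove) a := by
    rw [Finset.sum_congr rfl fun a _ => hsite a, Finset.sum_add_distrib]
    congr 1
    unfold siteEnergy
    rw [sum_erase_eq_sum_succAbove]
    exact Finset.sum_congr rfl fun a _ => by rw [dist_comm]
  rw [hsum] at h2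
  linarith

/-- Deleting a particle keeps injectivity. [folklore] -/
theorem injective_comp_succAbove {n : ℕ} {x : Fin (n + 1) → EuclideanSpace ℝ (Fin d)}
    (hx : Function.Injective x) (i : Fin (n + 1)) : Function.Injective (x ∘ i.succAbove) :=
  hx.comp Fin.succAbove_right_injective

/-- **Pruning lemma.** For `c ≥ 0`: `c`-stability of `g` on injective configurations all of whose site energies
are `≤ 0` implies `c`-stability of `g` on all injective configurations (delete a particle of positive site
energy and induct on `N`). [folklore] -/
theorem stable_of_stableOnPruned :
    ∀ (g : ℝ → ℝ) (c : ℝ), 0 ≤ c →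
      (∀ (N : ℕ) (x : Fin N → EuclideanSpace ℝ (Fin 3)), Function.Injective x →
        (∀ i, siteEnergy g x i ≤ 0) → -(c * (N : ℝ)) ≤ interactionEnergy g x) →
      ∀ (N : ℕ) (x : Fin N → EuclideanSpace ℝ (Fin 3)), Function.Injective x →
        -(c * (N : ℝ)) ≤ interactionEnergy g x := by
  intro g c hc h N
  induction N with
  | zero =>
    intro x _
    rw [interactionEnergy_of_subsingleton]
    simp
  | succ n ih =>
    intro x hx
    by_cases hall : ∀ i, siteEnergy g x i ≤ 0
    · exact h (n + 1) x hx hall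
    · push Not at hall
      obtain ⟨i, hi⟩ := hall
      have hrem := interactionEnergy_eq_succAbove_add_siteEnergy g x i
      have hih := ih (x ∘ i.succAbove) (injective_comp_succAbove hx i)
      push_cast
      linarith

end Summit.AtomisticToContinuum.Crystallization.Theorems.PerronGauge
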